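import Mathlib.FieldTheory.IsAlgClosed.AlgebraicClosure
import Mathlib.RingTheory.Jacobson.Radical
import Mathlib.Combinatorics.Enumerative.Partition.Basic
import Mathlib.LinearAlgebra.Dimension.Finrank
import Mathlib.Algebra.MonoidAlgebra.Module
import Literature.NumberTheory.DiophantineGeometry.PartitionTableaux
import HarnessLib

/-!
# James 1976/1978: the `p`-modular irreducible representations of `S_n` — dimension of the
# semisimple quotient of `F[S_n]`

Topic `Literature/RepresentationTheory/FiniteGroups`. ONE named fact (nothing asserted, no proof):

* `James1978_finrank_quotient_jacobson_le` — for a field `F` of prime characteristic `p`,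
  `dim_F F[S_n] / J(F[S_n]) ≤ ∑_{μ ⊢ n p-regular} (f^μ)²`.

Source. G. D. James, *The Representation Theory of the Symmetric Groups*, LNM 682 (1978),
Theorem 11.5 (= James, Bull. LMS 8 (1976)): over a field `F` of characteristic `p`, as `μ` varies
over the `p`-regular partitions of `n` (no nonzero part repeated `p` or more times, Def. 10.1),
`D^μ := S^μ/(S^μ ∩ S^μ⊥)` (Def. 11.2) varies over a complete set of inequivalent irreducible
`F S_n`-modules; each `D^μ` is self-dual and absolutely irreducible, and every field is a
splitting field for `S_n`. With Theorem 8.4 (the standard polytabloids form a basis of the Specht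
module `S^μ` over any field, so `dim_F S^μ = f^μ`, the number of standard `μ`-tableaux) this gives
`dim D^μ ≤ f^μ`, and Wedderburn–Artin for the split semisimple algebra
`F S_n / J(F S_n) ≅ ∏_{μ p-regular} M_{dim D^μ}(F)` gives
`dim_F F S_n/J(F S_n) = ∑_{μ p-regular} (dim D^μ)² ≤ ∑_{μ ⊢ n p-regular} (f^μ)²`,
which is the form recorded here (the dimensions `dim D^μ` themselves — the `p`-modular
decomposition numbers of `S_n` — have no closed form).

Why only a named fact: the tree's Specht modules (`Literature/NumberTheory/DiophantineGeometry/
SymmetricGroupReps*`) are Young-symmetrizer ideals in characteristic `0`; James' characteristic-free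
theory (polytabloids in the permutation module `M^μ`, the submodule theorem 4.8, the bilinear form
and `p`-regularity, §§4, 8, 10, 11) is not in Mathlib or the tree. Vocabulary: Mathlib's
`Nat.Partition.countRestricted n p` (partitions with every part used `< p` times = `p`-regular;
`countRestricted_two : countRestricted n 2 = distincts n`), `Ring.jacobson` (two-sided Jacobson
radical; for the Artinian algebra `F S_n` the largest nilpotent ideal), `MonoidAlgebra`,
`Module.finrank`; the tree's `numStandardTableaux` (`f^μ`). Used by the line
`two-modular-loewy-slice-rank` of `SnSubsetDichotomy.NoThresholdSubsetTriple` (MatrixMultiplication)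
at `p = 2`, `F = 𝔽̄₂`.

## References

* G. D. James, *The Representation Theory of the Symmetric Groups*, Lecture Notes in Mathematics
  682, Springer 1978, Theorems 4.9, 8.4, 11.1, 11.5, Definitions 10.1, 11.2. [JamesLNM682]
* G. D. James, *The irreducible representations of the symmetric groups*, Bull. London Math.
  Soc. 8 (1976) 229–232.
* C. W. Curtis, I. Reiner, *Representation Theory of Finite Groups and Associative Algebras*
  (1962), (83.5), (83.7) (splitting fields and the number of simple modules, as quoted by James in
  the proof of 11.5) and the Wedderburn structure theorem. [CurtisReiner1962]
-/

noncomputable section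

open scoped BigOperators

namespace Literature.RepresentationTheory.FiniteGroups

open Literature.NumberTheory.DiophantineGeometry (numStandardTableaux)

universe u

/-- **James 1976/1978 — the `p`-modular simple `F S_n`-modules are the `D^μ`, `μ` `p`-regular;
dimension of the semisimple quotient.** For a field `F` of prime characteristic `p` and every `n`:
`dim_F F[S_n] / J(F[S_n]) ≤ ∑_{μ ⊢ n, μ p-regular} (f^μ)²`
(James, LNM 682, Thm. 11.5: `{D^μ = S^μ/(S^μ ∩ S^μ⊥) : μ p-regular}` is a complete set of
inequivalent irreducible `F S_n`-modules, each absolutely irreducible; Thm. 8.4: `dim_F S^μ = f^μ`;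
hence by Wedderburn–Artin `dim F S_n/J = ∑_{μ p-regular} (dim D^μ)² ≤ ∑ (f^μ)²`). Here
`Nat.Partition.countRestricted n p` = the `p`-regular partitions of `n`, `Ring.jacobson` = the
Jacobson radical, `numStandardTableaux μ = f^μ`. Named fact, nothing asserted.
-- TODO(general form): the printed theorem is the classification itself (and also covers
-- characteristic `0`, "p = ∞", where every partition is regular).
[cite: JamesLNM682, Theorem 11.5] -/
def James1978_finrank_quotient_jacobson_le : Prop :=
  ∀ (p : ℕ) [Fact p.Prime] (F : Type u) [Field F] [CharP F p] (n : ℕ),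
    Module.finrank F (MonoidAlgebra F (Equiv.Perm (Fin n)) ⧸
        Ring.jacobson (MonoidAlgebra F (Equiv.Perm (Fin n)))) ≤
      ∑ μ ∈ Nat.Partition.countRestricted n p, numStandardTableaux μ ^ 2

end Literature.RepresentationTheory.FiniteGroups

end
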